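import Summits.FinalStateConjecture.FinalStateConjecture.Theses.HorizonTypeCascade
import HarnessLib

/-!
# Birth skeleton (BC3) — crux stmt-FinalStateConjecture-18557 `Theses.HorizonTypeCascade.NoMultiHorizonEquilibrium` (crux, rank 4)
# line `birth` (skeleton registrar planner-skel-stmt-FinalStateConjecture-18557-0, 2026-08-17; BC3 of run/shared/lean/lens3/_common/BC.md)

The crux (rev 4 of the route file, verbatim the route decl): an `I⁺`-regular, vacuum (`Ric = 0`), stationary asymptotically
flat black hole `𝓑 : StationaryAFBlackHole` with `𝓔⁺ ≠ ∅`, every connected component of whose future event horizon carries a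
NON-DEGENERATE KILLING COLLAR (a field `K` Killing on an open `U ⊇` the component, `[T, K] = 0` on `U`, `K ≠ 0` on the component,
`K`-integral curves from the component stay in `𝓔⁺`, `∇_K K = κ K` on the component with `κ ≠ 0`), has CONNECTED `𝓔⁺` — no
stationary vacuum multi-black-hole equilibrium in the smooth `I⁺`-regular category (CASCADE.md node 3; E_N of card
no-parking-ernst-riemann-hilbert).

THE CUT — the printed flow chart for the multi-component type (Chruściel–Costa–Heusler 2012 = arXiv:1205.6112, §3.3.1, §3.4.2,
§3.4.3 / Thm 3.6; the route header's own two-layer plan "NoMulti ⇐ StaticMultiHorizonConnected → RotatingMultiHorizonConnected",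
with the rotating half cut once more along the seam every source agrees on: RIGIDITY first, then the AXISYMMETRIC balance
problem).  By cases on whether the stationary Killing field `T` is null on all of `𝓔⁺`:
* (A) `g(T,T) ≡ 0` on `𝓔⁺` (every component non-rotating): `stub_staticSector` — VERBATIM the route's support item
  `StaticMultiHorizonConnected` (stmt-FinalStateConjecture-18561; `Iff.rfl` below): per-component Sudarsky–Wald staticity, then
  Bunting–Masood-ul-Alam 1987 / CCH12 Thm 3.1 (vendored: `Literature.Geometry.Lorentzian.BuntingMasoodUlAlam1987_horizonConnected`
  + `.of_nonRotating`, which wants ONE `κ` for all of `𝓔⁺`; the per-component-`κ` Sudarsky–Wald variant is cite item wi-37829).  Size M.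
* (B) `g(T,T)(p) ≠ 0` at some `p ∈ 𝓔⁺` (some component rotates):
  - `stub_collarRigidity` — Hawking rigidity WITHOUT analyticity and WITHOUT connectedness, from the collars: there is a complete
    axisymmetric Killing field `Y` commuting with `T` (`Spacetime.IsAxisymmetricKilling`, the conclusion shape of the route's
    `SmoothHawkingRigidity`, stmt-18788, which is the CONNECTED case of this stub).  OPEN (CCH12 §3.4.2: AIK arXiv:0902.1173 near Kerr
    only; Ionescu–Klainerman arXiv:1108.3575 local non-extension).  Size XL — load-bearing together with the next stub.
  - `stub_axisymmetricNoMulti` — the stationary-AXISYMMETRIC balance problem E_N: an `I⁺`-regular vacuum stationary-axisymmetric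
    black hole all of whose horizon components are non-degenerate (collared) has connected `𝓔⁺`.  Known for two components
    (CCH12 Thm 3.6 "I⁺-regular two-Kerr black holes do not exist": Neugebauer–Hennig arXiv:0905.4179, arXiv:1105.5830, Hennig–Neugebauer
    arXiv:1103.5248 (degenerate case), Chruściel–Eckstein–Nguyen–Szybka arXiv:1111.1448); "the case of more than two horizons is widely open"
    (CCH12 p. 14; Hennig arXiv:2009.03992 p. 3).  Weyl–Papapetrou / Ernst reduction: harmonic map to ℍ² with prescribed axis data
    (Weinstein 1990, Li–Tian), multi-Kerr–NUT candidates, force balance on the axis segments.  Size XL / open for n ≥ 3 — THE residue.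
`NoMultiHorizonEquilibrium_of : Sig.A → Sig.R → Sig.E → NoMultiHorizonEquilibrium` is the kernel-checked case analysis (real proof,
no `sorry`); `noMultiHorizonEquilibrium_of_stubs : NoMultiHorizonEquilibrium` is the crux BY NAME modulo the three stubs.  The `Sig.*`
legend defs are the stub signatures verbatim; the registered stubs are def-free, written in the route file's own dress
(fully-qualified `Literature.…` names, `open scoped Manifold` ambient as in every `Theses/*.lean`).

WHAT ANY PROOF MUST USE (refuter briefings on the item, REVIEW-HorizonTypeCascade.md / ATTACK.md, 2026-08-17): the "mutilated
Schwarzschild/Kerr" counter-models (remove a closed `T`-invariant band from `𝓔⁺`: vacuum, `T` complete, d.o.c. globally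
hyperbolic, two collared components) are excluded ONLY by the compact-cross-section / `closure_eq` / globally-hyperbolic-set
clauses of `IsIPlusRegular`; accordingly EVERY stub keeps `𝓑.IsIPlusRegular` (and `Ric = 0`, `𝓔⁺ ≠ ∅`, the collars) among its
hypotheses — stubs A and E conclude connectedness and so must consume them; stub R needs them for completeness of `Y`.
Disproof.lean: none exists for this crux (`ledger crux ls stmt-FinalStateConjecture-18557`: no workfiles at registration; no
`Theorems/NoMultiHorizonEquilibrium/Negative/`; no `_false_without_` obligations).  Negatives index (1 entry,
`not_UniformPhotonSphereChannels`): unrelated.  Dead lines: none recorded for this crux.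
-/

set_option linter.dupNamespace false

noncomputable section

open scoped Manifold ContDiff Topology
open Filter Set Function Literature.Geometry.Lorentzian

namespace Summit.FinalStateConjecture.FinalStateConjecture.Cruxes.NoMultiHorizonEquilibrium.Birth

open Summit.FinalStateConjecture.FinalStateConjecture.Theses.HorizonTypeCascade (NoMultiHorizonEquilibrium
  StaticMultiHorizonConnected NoMultiOfCases)

/-! ## Legend: the three stub statements as named propositions (verbatim the registered signatures) -/

/-- Statement of `stub_staticSector` (A): verbatim the route support item `StaticMultiHorizonConnected` (stmt-18561) — collared
`I⁺`-regular vacuum hole with `T` null on ALL of `𝓔⁺` has connected `𝓔⁺`. -/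
def Sig.stub_staticSector : Prop :=
  ∀ (𝓑 : Literature.Geometry.Lorentzian.StationaryAFBlackHole.{0}) [𝓑.metric.HasLeviCivita], 𝓑.IsIPlusRegular → 𝓑.metric.toPseudoRiemannianMetric.IsRicciFlat → 𝓑.horizon.Nonempty → (∀ p ∈ 𝓑.horizon, ∃ (U : Set 𝓑.carrier) (K : Π x : 𝓑.carrier, TangentSpace (𝓡 4) x) (κ : ℝ), IsOpen U ∧ connectedComponentIn 𝓑.horizon p ⊆ U ∧ ContMDiffOn (𝓡 4) ((𝓡 4).prod 𝓘(ℝ, Literature.Geometry.Lorentzian.E4)) ((⊤ : ℕ∞) : WithTop ℕ∞) (fun x ↦ (Bundle.TotalSpace.mk' Literature.Geometry.Lorentzian.E4 x (K x) : TangentBundle (𝓡 4) 𝓑.carrier)) U ∧ (∀ x ∈ U, ∀ v w : TangentSpace (𝓡 4) x, 𝓑.metric.val x (𝓑.metric.leviCivita K x v) w + 𝓑.metric.val x v (𝓑.metric.leviCivita K x w) = 0) ∧ (∀ x ∈ U, VectorField.mlieBracket (𝓡 4) 𝓑.killing K x = 0) ∧ (∀ q ∈ connectedComponentIn 𝓑.horizon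 p, K q ≠ 0) ∧ (∀ γ : ℝ → 𝓑.carrier, IsMIntegralCurve γ K → γ 0 ∈ connectedComponentIn 𝓑.horizon p → ∀ t, γ t ∈ 𝓑.horizon) ∧ κ ≠ 0 ∧ ∀ q ∈ connectedComponentIn 𝓑.horizon p, 𝓑.metric.leviCivita K q (K q) = κ • K q) → (∀ p ∈ 𝓑.horizon, 𝓑.metric.val p (𝓑.killing p) (𝓑.killing p) = 0) → IsConnected 𝓑.horizon

/-- Statement of `stub_collarRigidity` (R): collared `I⁺`-regular vacuum hole (any number of components) with `T` non-null
somewhere on `𝓔⁺` carries a complete axisymmetric Killing field commuting with `T`. -/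
def Sig.stub_collarRigidity : Prop :=
  ∀ (𝓑 : Literature.Geometry.Lorentzian.StationaryAFBlackHole.{0}) [𝓑.metric.HasLeviCivita], 𝓑.IsIPlusRegular → 𝓑.metric.toPseudoRiemannianMetric.IsRicciFlat → 𝓑.horizon.Nonempty → (∀ p ∈ 𝓑.horizon, ∃ (U : Set 𝓑.carrier) (K : Π x : 𝓑.carrier, TangentSpace (𝓡 4) x) (κ : ℝ), IsOpen U ∧ connectedComponentIn 𝓑.horizon p ⊆ U ∧ ContMDiffOn (𝓡 4) ((𝓡 4).prod 𝓘(ℝ, Literature.Geometry.Lorentzian.E4)) ((⊤ : ℕ∞) : WithTop ℕ∞) (fun x ↦ (Bundle.TotalSpace.mk' Literature.Geometry.Lorentzian.E4 x (K x) : TangentBundle (𝓡 4) 𝓑.carrier)) U ∧ (∀ x ∈ U, ∀ v w : TangentSpace (𝓡 4) x, 𝓑.metric.val x (𝓑.metric.leviCivita K x v) w + 𝓑.metric.val x v (𝓑.metric.leviCivita K x w) = 0) ∧ (∀ x ∈ U, VectorField.mlieBracket (𝓡 4) 𝓑.killing K x = 0) ∧ (∀ q ∈ connectedComponentIn 𝓑.horizon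 p, K q ≠ 0) ∧ (∀ γ : ℝ → 𝓑.carrier, IsMIntegralCurve γ K → γ 0 ∈ connectedComponentIn 𝓑.horizon p → ∀ t, γ t ∈ 𝓑.horizon) ∧ κ ≠ 0 ∧ ∀ q ∈ connectedComponentIn 𝓑.horizon p, 𝓑.metric.leviCivita K q (K q) = κ • K q) → (∃ p ∈ 𝓑.horizon, 𝓑.metric.val p (𝓑.killing p) (𝓑.killing p) ≠ 0) → ∃ Y : Π x : 𝓑.carrier, TangentSpace (𝓡 4) x, 𝓑.toSpacetime.IsAxisymmetricKilling Y ∧ ∀ x, VectorField.mlieBracket (𝓡 4) 𝓑.killing Y x = 0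

/-- Statement of `stub_axisymmetricNoMulti` (E): collared `I⁺`-regular vacuum hole which is stationary-AXISYMMETRIC has connected
`𝓔⁺` (no non-degenerate multi-component stationary-axisymmetric vacuum equilibrium, E_N for every N). -/
def Sig.stub_axisymmetricNoMulti : Prop :=
  ∀ (𝓑 : Literature.Geometry.Lorentzian.StationaryAFBlackHole.{0}) [𝓑.metric.HasLeviCivita], 𝓑.IsIPlusRegular → 𝓑.metric.toPseudoRiemannianMetric.IsRicciFlat → 𝓑.horizon.Nonempty → (∀ p ∈ 𝓑.horizon, ∃ (U : Set 𝓑.carrier) (K : Π x : 𝓑.carrier, TangentSpace (𝓡 4) x) (κ : ℝ), IsOpen U ∧ connectedComponentIn 𝓑.horizon p ⊆ U ∧ ContMDiffOn (𝓡 4) ((𝓡 4).prod 𝓘(ℝ, Literature.Geometry.Lorentzian.E4)) ((⊤ : ℕ∞) : WithTop ℕ∞) (fun x ↦ (Bundle.TotalSpace.mk' Literature.Geometry.Lorentzian.E4 x (K x) : TangentBundle (𝓡 4) 𝓑.carrier)) U ∧ (∀ x ∈ U, ∀ v w : TangentSpace (𝓡 4) x, 𝓑.metric.val x (𝓑.metric.leviCivita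 K x v) w + 𝓑.metric.val x v (𝓑.metric.leviCivita K x w) = 0) ∧ (∀ x ∈ U, VectorField.mlieBracket (𝓡 4) 𝓑.killing K x = 0) ∧ (∀ q ∈ connectedComponentIn 𝓑.horizon p, K q ≠ 0) ∧ (∀ γ : ℝ → 𝓑.carrier, IsMIntegralCurve γ K → γ 0 ∈ connectedComponentIn 𝓑.horizon p → ∀ t, γ t ∈ 𝓑.horizon) ∧ κ ≠ 0 ∧ ∀ q ∈ connectedComponentIn 𝓑.horizon p, 𝓑.metric.leviCivita K q (K q) = κ • K q) → (∃ Y : Π x : 𝓑.carrier, TangentSpace (𝓡 4) x, 𝓑.toSpacetime.IsAxisymmetricKilling Y ∧ ∀ x, VectorField.mlieBracket (𝓡 4) 𝓑.killing Y x = 0) → IsConnected 𝓑.horizon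

/-! ## Registered stubs (`sorry` only here; signatures def-free, in the route file's dress) -/

/-- **A — STATIC SECTOR (= route support item `StaticMultiHorizonConnected`, stmt-FinalStateConjecture-18561; size M, ROUTINE
from literature).**  An `I⁺`-regular, Ricci-flat stationary AF black hole with `𝓔⁺ ≠ ∅`, a non-degenerate Killing collar on every
horizon component, and stationary Killing field `T` NULL ON ALL OF `𝓔⁺` (no component rotates) has connected `𝓔⁺`.  Why plausibly
true: on each component the collar field is proportional to `T` (both null and tangent to the generators), so `T ≠ 0` and
`∇_T T = κᵢ T` there with `κᵢ ≠ 0`; per-component Sudarsky–Wald (doi:10.1103/PhysRevD.47.R5209; cite item wi-37829 for the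
per-component-`κ` form) makes `⟨⟨M_ext⟩⟩` static, and Bunting–Masood-ul-Alam (doi:10.1007/BF00770326) in the analyticity-free
form CCH12 Thm 3.1 — vendored as `Literature.Geometry.Lorentzian.BuntingMasoodUlAlam1987_horizonConnected` — gives one component.
Why it might fail: only the dress — converting per-component collars with possibly different `κᵢ` to the single-`κ` hypothesis of
the vendored `.of_nonRotating`, and the GLOBAL `IsMIntegralCurve` tangency clause (grounder flag) — the mathematics is in print.
Leans on: `StaticVacuumHorizonConnected.lean`, `NonRotatingBlackHoleUniqueness.lean` (`SudarskyWald1993_staticity`),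
`IPlusRegular.lean`. [ChruscielCostaHeusler2012 §3.3.1, Thm 3.1; SudarskyWald1993; BuntingMasoodUlAlam1987] -/
theorem stub_staticSector : ∀ (𝓑 : Literature.Geometry.Lorentzian.StationaryAFBlackHole.{0}) [𝓑.metric.HasLeviCivita], 𝓑.IsIPlusRegular → 𝓑.metric.toPseudoRiemannianMetric.IsRicciFlat → 𝓑.horizon.Nonempty → (∀ p ∈ 𝓑.horizon, ∃ (U : Set 𝓑.carrier) (K : Π x : 𝓑.carrier, TangentSpace (𝓡 4) x) (κ : ℝ), IsOpen U ∧ connectedComponentIn 𝓑.horizon p ⊆ U ∧ ContMDiffOn (𝓡 4) ((𝓡 4).prod 𝓘(ℝ, Literature.Geometry.Lorentzian.E4)) ((⊤ : ℕ∞) : WithTop ℕ∞) (fun x ↦ (Bundle.TotalSpace.mk' Literature.Geometry.Lorentzian.E4 x (K x) : TangentBundle (𝓡 4) 𝓑.carrier)) U ∧ (∀ x ∈ U, ∀ v w : TangentSpace (𝓡 4) x, 𝓑.metric.val x (𝓑.metric.leviCivita K x v) w + 𝓑.metric.val x v (𝓑.metric.leviCivita K x w) = 0) ∧ (∀ x ∈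 U, VectorField.mlieBracket (𝓡 4) 𝓑.killing K x = 0) ∧ (∀ q ∈ connectedComponentIn 𝓑.horizon p, K q ≠ 0) ∧ (∀ γ : ℝ → 𝓑.carrier, IsMIntegralCurve γ K → γ 0 ∈ connectedComponentIn 𝓑.horizon p → ∀ t, γ t ∈ 𝓑.horizon) ∧ κ ≠ 0 ∧ ∀ q ∈ connectedComponentIn 𝓑.horizon p, 𝓑.metric.leviCivita K q (K q) = κ • K q) → (∀ p ∈ 𝓑.horizon, 𝓑.metric.val p (𝓑.killing p) (𝓑.killing p) = 0) → IsConnected 𝓑.horizon := by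
  sorry

/-- **R — COLLAR RIGIDITY WITHOUT ANALYTICITY OR CONNECTEDNESS (size XL; OPEN).**  An `I⁺`-regular, Ricci-flat stationary AF
black hole with `𝓔⁺ ≠ ∅`, a non-degenerate Killing collar on every horizon component, and `g(T,T)(p) ≠ 0` at some `p ∈ 𝓔⁺`
(some component ROTATES) carries a complete axisymmetric Killing field `Y` (`Spacetime.IsAxisymmetricKilling`: Killing, complete,
`2π`-periodic orbits, non-trivial, non-empty axis) commuting with `T`.  Why plausibly true: on the rotating component the collar
field is `K = T + Ω Y₀` with `Ω ≠ 0`, so `Y₀ := (K - T)/Ω` is a Killing field near that component with closed orbits; Hawking's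
theorem (analytic case: Chruściel–Costa arXiv:0806.0016 Thm 1.1/§4, ALL components, different angular velocities allowed) and
Alexakis–Ionescu–Klainerman (smooth, near-Kerrian: arXiv:0902.1173, arXiv:1304.0487) extend it to `⟨⟨M_ext⟩⟩`; the collar is
exactly the local input AIK's unique continuation starts from.  Why it might fail: = rigidity without analyticity, "the general
case remains open" (CCH12 §3.4.2 p. 13); Ionescu–Klainerman local hair (arXiv:1108.3575 Thm 1.3; barrier
`Literature.Barriers.FinalStateConjecture.IonescuKlainermanNonExtension`) shows a Killing field along a bifurcate horizon need not
extend without pseudo-convexity — the multi-component ergoregion geometry is uncharted.  The CONNECTED case is the route's own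
support item `SmoothHawkingRigidity` (stmt-18788); this stub is its multi-component strengthening and shares its sector
(BeltLiouville / ZeroEnergyKerrOrBomb / AnalyticityInvadesErgoregion lines).  Leans on: `Stationary.lean`
(`Spacetime.IsAxisymmetricKilling`), `IPlusRegular.lean`, `BlackHoles.lean` (`AlexakisIonescuKlainermanRigidity` schema, hypothesis
shape only). [ChruscielCosta2008; AlexakisIonescuKlainerman2009; IonescuKlainerman2012; ChruscielCostaHeusler2012 §3.4.2] -/
theorem stub_collarRigidity : ∀ (𝓑 : Literature.Geometry.Lorentzian.StationaryAFBlackHole.{0}) [𝓑.metric.HasLeviCivita], 𝓑.IsIPlusRegular → 𝓑.metric.toPseudoRiemannianMetric.IsRicciFlat → 𝓑.horizon.Nonempty → (∀ p ∈ 𝓑.horizon, ∃ (U : Set 𝓑.carrier) (K : Π x : 𝓑.carrier, TangentSpace (𝓡 4) x) (κ : ℝ), IsOpen U ∧ connectedComponentIn 𝓑.horizon p ⊆ U ∧ ContMDiffOn (𝓡 4) ((𝓡 4).prod 𝓘(ℝ, Literature.Geometry.Lorentzian.E4)) ((⊤ : ℕ∞) : WithTop ℕ∞) (fun x ↦ (Bundle.TotalSpace.mk'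 Literature.Geometry.Lorentzian.E4 x (K x) : TangentBundle (𝓡 4) 𝓑.carrier)) U ∧ (∀ x ∈ U, ∀ v w : TangentSpace (𝓡 4) x, 𝓑.metric.val x (𝓑.metric.leviCivita K x v) w + 𝓑.metric.val x v (𝓑.metric.leviCivita K x w) = 0) ∧ (∀ x ∈ U, VectorField.mlieBracket (𝓡 4) 𝓑.killing K x = 0) ∧ (∀ q ∈ connectedComponentIn 𝓑.horizon p, K q ≠ 0) ∧ (∀ γ : ℝ → 𝓑.carrier, IsMIntegralCurve γ K → γ 0 ∈ connectedComponentIn 𝓑.horizon p → ∀ t, γ t ∈ 𝓑.horizon) ∧ κ ≠ 0 ∧ ∀ q ∈ connectedComponentIn 𝓑.horizon p, 𝓑.metric.leviCivita K q (K q) = κ • K q) → (∃ p ∈ 𝓑.horizon, 𝓑.metric.val p (𝓑.killing p) (𝓑.killing p) ≠ 0) → ∃ Y : Π x : 𝓑.carrier, TangentSpace (𝓡 4) x, 𝓑.toSpacetime.IsAxisymmetricKilling Y ∧ ∀ x, VectorField.mlieBracket (𝓡 4) 𝓑.killing Y x = 0 := by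
  sorry

/-- **E — NO AXISYMMETRIC MULTI-HORIZON EQUILIBRIUM, E_N (size XL; known N = 2, OPEN N ≥ 3 — the residue of the crux).**  An
`I⁺`-regular, Ricci-flat, stationary AND AXISYMMETRIC (`∃ Y`, `IsAxisymmetricKilling Y`, `[T, Y] = 0`) AF black hole with
`𝓔⁺ ≠ ∅` and a non-degenerate Killing collar on every horizon component has connected `𝓔⁺`.  Why plausibly true: in the
stationary-axisymmetric `I⁺`-regular vacuum class the Weyl–Papapetrou / Ernst reduction (CC08 §6, CCH12 §3.2.2) turns the d.o.c.
into a harmonic map `ℝ³ ∖ axis → ℍ²` with prescribed singular boundary data on N horizon rods (Weinstein CPAM 43 (1990), Li–Tian);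
candidates with N non-degenerate rods are the multi-Kerr–NUT family, and regularity of the axis between rods (no strut, no NUT
charge) is an over-determined force-balance condition: for N = 2 it has no solution (Neugebauer–Hennig arXiv:0905.4179 and
arXiv:1105.5830 = J. Geom. Phys. 62 (2012) 613, Hennig–Neugebauer arXiv:1103.5248 for the degenerate case, with the area–angular-momentum
inequality; Chruściel–Eckstein–Nguyen–Szybka arXiv:1111.1448; CCH12 Thm 3.6 "I⁺-regular two-Kerr black holes do not exist"); the
static sub-case is Bunting–Masood-ul-Alam for every N.  Why it might fail:
"the case of more than two horizons is widely open" (CCH12 p. 14 l. 28–32; Hennig arXiv:2009.03992 p. 3: the general balance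
problem "is probably far out of reach"); a regular N ≥ 3 co-axial spinning equilibrium (spin–spin repulsion balancing attraction)
would refute it AND the summit's Kerr form.  Leans on: `ErnstAxisBVP.lean` (Neugebauer–Hennig hypothesis vocabulary),
`AxisymmetricBlackHoleUniqueness*.lean` (orbit-space facts for `IsAxisymmetricKilling`), `StaticVacuumHorizonConnected.lean`;
cite item wi-37831 (CCH12 Thm 3.6, not yet vendored). [ChruscielCostaHeusler2012 Thm 3.6; arXiv:0905.4179; arXiv:1105.5830;
arXiv:1103.5248; arXiv:1111.1448; Weinstein1990; arXiv:2009.03992; arXiv:2212.14826] -/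
theorem stub_axisymmetricNoMulti : ∀ (𝓑 : Literature.Geometry.Lorentzian.StationaryAFBlackHole.{0}) [𝓑.metric.HasLeviCivita], 𝓑.IsIPlusRegular → 𝓑.metric.toPseudoRiemannianMetric.IsRicciFlat → 𝓑.horizon.Nonempty → (∀ p ∈ 𝓑.horizon, ∃ (U : Set 𝓑.carrier) (K : Π x : 𝓑.carrier, TangentSpace (𝓡 4) x) (κ : ℝ), IsOpen U ∧ connectedComponentIn 𝓑.horizon p ⊆ U ∧ ContMDiffOn (𝓡 4) ((𝓡 4).prod 𝓘(ℝ, Literature.Geometry.Lorentzian.E4)) ((⊤ : ℕ∞) : WithTop ℕ∞) (fun x ↦ (Bundle.TotalSpace.mk' Literature.Geometry.Lorentzian.E4 x (K x) : TangentBundle (𝓡 4) 𝓑.carrier)) U ∧ (∀ x ∈ U, ∀ v w : TangentSpace (𝓡 4) x, 𝓑.metric.val x (𝓑.metric.leviCivita K x v) w + 𝓑.metric.val x v (𝓑.metric.leviCivita K x w) = 0) ∧ (∀ x ∈ U, VectorField.mlieBracket (𝓡 4) 𝓑.killing K x = 0) ∧ (∀ q ∈ connectedComponentIn 𝓑.horizon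 p, K q ≠ 0) ∧ (∀ γ : ℝ → 𝓑.carrier, IsMIntegralCurve γ K → γ 0 ∈ connectedComponentIn 𝓑.horizon p → ∀ t, γ t ∈ 𝓑.horizon) ∧ κ ≠ 0 ∧ ∀ q ∈ connectedComponentIn 𝓑.horizon p, 𝓑.metric.leviCivita K q (K q) = κ • K q) → (∃ Y : Π x : 𝓑.carrier, TangentSpace (𝓡 4) x, 𝓑.toSpacetime.IsAxisymmetricKilling Y ∧ ∀ x, VectorField.mlieBracket (𝓡 4) 𝓑.killing Y x = 0) → IsConnected 𝓑.horizon := by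
  sorry

/-! ## The composition (sorry-free): stubs A, R, E ⟹ the route decl, by name -/

/-- **`NoMultiHorizonEquilibrium` from A, R, E** — case analysis on whether the stationary Killing field is null on all of
`𝓔⁺`: if some horizon point has `g(T,T) ≠ 0`, collar rigidity (R) produces the axisymmetric Killing field and the axisymmetric
balance theorem (E) gives connectedness; otherwise every component is non-rotating and the static sector (A) applies. -/
theorem NoMultiHorizonEquilibrium_of :
    Sig.stub_staticSector → Sig.stub_collarRigidity → Sig.stub_axisymmetricNoMulti → NoMultiHorizonEquilibrium := by
  intro hA hR hE 𝓑 _ hreg hvac hne hcol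
  by_cases hrot : ∃ p ∈ 𝓑.horizon, 𝓑.metric.val p (𝓑.killing p) (𝓑.killing p) ≠ 0
  · -- (B) some component rotates: rigidity, then the axisymmetric balance problem
    exact hE 𝓑 hreg hvac hne hcol (hR 𝓑 hreg hvac hne hcol hrot)
  · -- (A) `T` null on all of `𝓔⁺`: the static sector
    have hnull : ∀ p ∈ 𝓑.horizon, 𝓑.metric.val p (𝓑.killing p) (𝓑.killing p) = 0 := by
      intro p hp
      by_contra h
      exact hrot ⟨p, hp, h⟩
    exact hA 𝓑 hreg hvac hne hcol hnull

/-- The crux by name, closed modulo the three registered stubs. -/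
theorem noMultiHorizonEquilibrium_of_stubs : NoMultiHorizonEquilibrium :=
  NoMultiHorizonEquilibrium_of stub_staticSector stub_collarRigidity stub_axisymmetricNoMulti

/-! ## Sanity (kernel-checked bookkeeping, no content): the stubs in the route's own vocabulary -/

/-- Stub A IS the route support item `StaticMultiHorizonConnected` (stmt-FinalStateConjecture-18561), token for token. -/
example : Sig.stub_staticSector ↔ StaticMultiHorizonConnected := Iff.rfl

/-- Stubs R and E together give the "rotating multi-horizon case ⇒ connected" hypothesis of the route support item
`NoMultiOfCases` (stmt-FinalStateConjecture-18563), so this skeleton refines the route's declared two-layer plan. -/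
example (hR : Sig.stub_collarRigidity) (hE : Sig.stub_axisymmetricNoMulti) :
    ∀ (𝓑 : Literature.Geometry.Lorentzian.StationaryAFBlackHole.{0}) [𝓑.metric.HasLeviCivita], 𝓑.IsIPlusRegular → 𝓑.metric.toPseudoRiemannianMetric.IsRicciFlat → 𝓑.horizon.Nonempty → (∀ p ∈ 𝓑.horizon, ∃ (U : Set 𝓑.carrier) (K : Π x : 𝓑.carrier, TangentSpace (𝓡 4) x) (κ : ℝ), IsOpen U ∧ connectedComponentIn 𝓑.horizon p ⊆ U ∧ ContMDiffOn (𝓡 4) ((𝓡 4).prod 𝓘(ℝ, Literature.Geometry.Lorentzian.E4)) ((⊤ : ℕ∞) : WithTop ℕ∞) (fun x ↦ (Bundle.TotalSpace.mk' Literature.Geometry.Lorentzian.E4 x (K x) : TangentBundle (𝓡 4) 𝓑.carrier)) U ∧ (∀ x ∈ U, ∀ v w : TangentSpace (𝓡 4) x, 𝓑.metric.val x (𝓑.metric.leviCivita K x v) w + 𝓑.metric.val x v (𝓑.metric.leviCivita K x w) = 0) ∧ (∀ x ∈ U, VectorField.mlieBracket (𝓡 4) 𝓑.killing K x = 0) ∧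 (∀ q ∈ connectedComponentIn 𝓑.horizon p, K q ≠ 0) ∧ (∀ γ : ℝ → 𝓑.carrier, IsMIntegralCurve γ K → γ 0 ∈ connectedComponentIn 𝓑.horizon p → ∀ t, γ t ∈ 𝓑.horizon) ∧ κ ≠ 0 ∧ ∀ q ∈ connectedComponentIn 𝓑.horizon p, 𝓑.metric.leviCivita K q (K q) = κ • K q) → (∃ p ∈ 𝓑.horizon, 𝓑.metric.val p (𝓑.killing p) (𝓑.killing p) ≠ 0) → IsConnected 𝓑.horizon :=
  fun 𝓑 _ hreg hvac hne hcol hrot ↦ hE 𝓑 hreg hvac hne hcol (hR 𝓑 hreg hvac hne hcol hrot)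

end Summit.FinalStateConjecture.FinalStateConjecture.Cruxes.NoMultiHorizonEquilibrium.Birth

end
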